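import Mathlib

/-!
# PneNP / OverlapGapAlgebra — crux `SolvableImpliesStableSection` (stmt-PneNP-2463):
# the PEELING block (1/5) — exact counts of path patterns

Support for crux `stmt-PneNP-2463` (`Summit.PneNP.PneNP.Theses.OverlapGapAlgebra.SolvableImpliesStableSection`):
the f-free block "bounded-round private-variable peeling gives stable sections for `k α < 1`".
A clause of `F_k(n, m)` that survives `R` rounds of parallel peeling (a clause is peeled as soon as one of
its variables occurs in no other surviving clause) has a WITNESS PATH `c₀ = i, c₁, …, c_R` of clauses with
up-slots `u_d`: clause `c_{d+1} ≠ c_d` carries at slot `u_{d+1}` the variable of slot `dn(u_d) ≠ u_d` of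
`c_d`.  This file counts the instances `Φ : Fin m → Fin k → Fin n × Bool` realising such slot equations:

* `sissP_card_filter_slot_mul` — the slot fibre: if `P` and `w` do not read the VARIABLE of slot
  `(c, j)`, then `#{Φ : P Φ ∧ var(c, j) = w Φ} · n = #{Φ : P Φ}`;
* `sissP_pathCount` — for an injective clause sequence, the `L` path equations are realised by exactly
  `#Inst / n^L` instances: `#{Φ : eqs} · n^L = #Inst`;
* `sissP_pathCount_extra` — with one more equation tying a FRESH slot `(c_L, dn u_L)` of the last clause to
  any slot of an earlier clause: `#{Φ : eqs ∧ extra} · n^{L+1} = #Inst` (the first collision of a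
  witness path costs a further factor `1/n`).
Pure counting over `Fin m → Fin k → Fin n × Bool`; no definitions; axioms `propext`, `Classical.choice`,
`Quot.sound`.
-/

set_option linter.dupNamespace false -- `Summit.PneNP.PneNP.…`: summit = sub-problem (D-0017)

namespace Summit.PneNP.PneNP.Theorems

open Finset
open scoped Classical

section PeelPath

variable {m k n : ℕ}

/-- Re-setting the variable of slot `(c, j)` (keeping its sign): the new slot value. -/
private theorem sissP_setv_apply (Φ : Fin m → Fin k → Fin n × Bool) (c : Fin m) (j : Fin k) (x : Fin n) :
    Function.update Φ c (Function.update (Φ c) j (x, (Φ c j).2)) c j = (x, (Φ c j).2) := by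
  simp

/-- Re-setting the variable of slot `(c, j)` twice is re-setting it once. -/
private theorem sissP_setv_setv (Φ : Fin m → Fin k → Fin n × Bool) (c : Fin m) (j : Fin k)
    (x y : Fin n) :
    (fun Ψ : Fin m → Fin k → Fin n × Bool =>
        Function.update Ψ c (Function.update (Ψ c) j (y, (Ψ c j).2)))
      (Function.update Φ c (Function.update (Φ c) j (x, (Φ c j).2)))
      = Function.update Φ c (Function.update (Φ c) j (y, (Φ c j).2)) := by
  funext a b
  by_cases ha : a = c
  · subst ha
    by_cases hb : b = j
    · subst hb; simp
    · simp [hb]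
  · simp [ha]

/-- Re-setting the variable of slot `(c, j)` to its own value does nothing. -/
private theorem sissP_setv_self (Φ : Fin m → Fin k → Fin n × Bool) (c : Fin m) (j : Fin k) :
    Function.update Φ c (Function.update (Φ c) j ((Φ c j).1, (Φ c j).2)) = Φ := by
  simp

/-- **The slot fibre.** If the predicate `P` and the function `w` do not read the variable of slot
`(c, j)` (they are invariant under re-setting it), then among the instances satisfying `P` exactly a
`1/n` fraction has `var(c, j) = w`: `#{Φ : P Φ ∧ (Φ c j).1 = w Φ} · n = #{Φ : P Φ}`. -/
theorem sissP_card_filter_slot_mul (c : Fin m) (j : Fin k)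
    (P : (Fin m → Fin k → Fin n × Bool) → Prop) [DecidablePred P]
    (w : (Fin m → Fin k → Fin n × Bool) → Fin n)
    (hP : ∀ (Φ : Fin m → Fin k → Fin n × Bool) (x : Fin n),
      P (Function.update Φ c (Function.update (Φ c) j (x, (Φ c j).2))) ↔ P Φ)
    (hw : ∀ (Φ : Fin m → Fin k → Fin n × Bool) (x : Fin n),
      w (Function.update Φ c (Function.update (Φ c) j (x, (Φ c j).2))) = w Φ) :
    ((univ : Finset (Fin m → Fin k → Fin n × Bool)).filter fun Φ => P Φ ∧ (Φ c j).1 = w Φ).card * n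
      = ((univ : Finset (Fin m → Fin k → Fin n × Bool)).filter fun Φ => P Φ).card := by
  set T : (Fin m → Fin k → Fin n × Bool) → Fin n → (Fin m → Fin k → Fin n × Bool) := fun Φ x =>
    Function.update Φ c (Function.update (Φ c) j (x, (Φ c j).2)) with hT
  have hTapply : ∀ Φ x, (T Φ x) c j = (x, (Φ c j).2) := fun Φ x => sissP_setv_apply Φ c j x
  have hTT : ∀ Φ x y, T (T Φ x) y = T Φ y := fun Φ x y => by
    have := sissP_setv_setv Φ c j x y
    simpa only [hT] using this
  have hTself : ∀ Φ, T Φ (Φ c j).1 = Φ := fun Φ => by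
    have := sissP_setv_self Φ c j
    simpa only [hT] using this
  set A := (univ : Finset (Fin m → Fin k → Fin n × Bool)).filter fun Φ => P Φ ∧ (Φ c j).1 = w Φ
    with hA
  set B := (univ : Finset (Fin m → Fin k → Fin n × Bool)).filter fun Φ => P Φ with hB
  have hcard : (A ×ˢ (univ : Finset (Fin n))).card = B.card := by
    refine Finset.card_bij' (fun p _ => T p.1 p.2) (fun Φ _ => (T Φ (w Φ), (Φ c j).1)) ?_ ?_ ?_ ?_
    · rintro ⟨Φ, x⟩ hp
      rw [Finset.mem_product, hA, Finset.mem_filter] at hp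
      rw [hB, Finset.mem_filter]
      exact ⟨mem_univ _, (hP Φ x).2 hp.1.2.1⟩
    · intro Φ hΦ
      rw [hB, Finset.mem_filter] at hΦ
      rw [Finset.mem_product, hA, Finset.mem_filter]
      refine ⟨⟨mem_univ _, (hP Φ _).2 hΦ.2, ?_⟩, mem_univ _⟩
      show ((T Φ (w Φ)) c j).1 = w (T Φ (w Φ))
      rw [hTapply, hw]
    · rintro ⟨Φ, x⟩ hp
      rw [Finset.mem_product, hA, Finset.mem_filter] at hp
      have heq : (Φ c j).1 = w Φ := hp.1.2.2
      ext1
      · show T (T Φ x) (w (T Φ x)) = Φ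
        rw [hw, hTT, ← heq, hTself]
      · show ((T Φ x) c j).1 = x
        rw [hTapply]
    · intro Φ _
      show T (T Φ (w Φ)) (Φ c j).1 = Φ
      rw [hTT, hTself]
  rw [← hcard, Finset.card_product, Finset.card_univ, Fintype.card_fin]

/-- **Exact count of an injective path pattern.** Let `c : ℕ → Fin m` be injective on `[0, L]`,
`u : ℕ → Fin k` arbitrary and `dn : Fin k → Fin k` arbitrary. The instances in which, for every `d < L`,
clause `c (d+1)` carries at slot `u (d+1)` the variable of slot `dn (u d)` of clause `c d` number exactly
`#Inst / n^L`: `#{Φ : eqs} · n^L = #Inst`. -/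
theorem sissP_pathCount (dn : Fin k → Fin k) (u : ℕ → Fin k) :
    ∀ (L : ℕ) (c : ℕ → Fin m), (∀ a b, a ≤ L → b ≤ L → c a = c b → a = b) →
      ((univ : Finset (Fin m → Fin k → Fin n × Bool)).filter fun Φ =>
          ∀ d, d < L → (Φ (c (d + 1)) (u (d + 1))).1 = (Φ (c d) (dn (u d))).1).card * n ^ L
        = Fintype.card (Fin m → Fin k → Fin n × Bool) := by
  intro L
  induction L with
  | zero =>
    intro c _
    simp
  | succ L ih =>
    intro c hinj
    have hinjL : ∀ a b, a ≤ L → b ≤ L → c a = c b → a = b :=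
      fun a b ha hb h => hinj a b (Nat.le_succ_of_le ha) (Nat.le_succ_of_le hb) h
    have hIH := ih c hinjL
    -- the last clause `c (L+1)` is read by no earlier equation
    have hne : ∀ d, d ≤ L → c d ≠ c (L + 1) := by
      intro d hd h
      have := hinj d (L + 1) (Nat.le_succ_of_le hd) le_rfl h
      omega
    have hstep := sissP_card_filter_slot_mul (n := n) (c (L + 1)) (u (L + 1))
      (fun Φ => ∀ d, d < L → (Φ (c (d + 1)) (u (d + 1))).1 = (Φ (c d) (dn (u d))).1)
      (fun Φ => (Φ (c L) (dn (u L))).1) ?_ ?_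
    rotate_left
    · intro Φ x
      refine forall_congr' fun d => forall_congr' fun hd => ?_
      have h1 : c (d + 1) ≠ c (L + 1) := hne (d + 1) (by omega)
      have h2 : c d ≠ c (L + 1) := hne d (by omega)
      rw [Function.update_of_ne h1, Function.update_of_ne h2]
    · intro Φ x
      have h2 : c L ≠ c (L + 1) := hne L le_rfl
      simp only [Function.update_of_ne h2]
    -- `eqs (L+1) = eqs L ∧ last`
    have hsplit : ((univ : Finset (Fin m → Fin k → Fin n × Bool)).filter fun Φ =>
          ∀ d, d < L + 1 → (Φ (c (d + 1)) (u (d + 1))).1 = (Φ (c d) (dn (u d))).1)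
        = (univ : Finset (Fin m → Fin k → Fin n × Bool)).filter fun Φ =>
          (∀ d, d < L → (Φ (c (d + 1)) (u (d + 1))).1 = (Φ (c d) (dn (u d))).1) ∧
            (Φ (c (L + 1)) (u (L + 1))).1 = (Φ (c L) (dn (u L))).1 := by
      refine Finset.filter_congr fun Φ _ => ⟨fun h => ⟨fun d hd => h d (by omega), h L (by omega)⟩,
        fun h d hd => ?_⟩
      rcases Nat.lt_succ_iff_lt_or_eq.1 hd with hd' | rfl
      · exact h.1 d hd'
      · exact h.2
    rw [hsplit, pow_succ, ← mul_assoc, mul_comm _ n, ← mul_assoc, mul_comm n, ← hIH]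
    congr 1

/-- **Exact count of an injective path pattern with one collision equation.** As `sissP_pathCount`
(`c` injective on `[0, L]`, `dn u ≠ u` at the last up-slot), plus one more equation tying the FRESH
slot `(c L, dn (u L))` of the last clause to slot `j` of an earlier clause `c a`, `a < L`:
`#{Φ : eqs ∧ var(c L, dn (u L)) = var(c a, j)} · n^{L+1} = #Inst`. -/
theorem sissP_pathCount_extra (dn : Fin k → Fin k) (u : ℕ → Fin k) (L : ℕ) (c : ℕ → Fin m)
    (hinj : ∀ a b, a ≤ L → b ≤ L → c a = c b → a = b) (hdn : dn (u L) ≠ u L)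
    (a : ℕ) (ha : a < L) (j : Fin k) :
    ((univ : Finset (Fin m → Fin k → Fin n × Bool)).filter fun Φ =>
        (∀ d, d < L → (Φ (c (d + 1)) (u (d + 1))).1 = (Φ (c d) (dn (u d))).1) ∧
          (Φ (c L) (dn (u L))).1 = (Φ (c a) j).1).card * n ^ (L + 1)
      = Fintype.card (Fin m → Fin k → Fin n × Bool) := by
  have hne : ∀ d, d < L → c d ≠ c L := by
    intro d hd h
    have := hinj d L hd.le le_rfl h
    omega
  have hstep := sissP_card_filter_slot_mul (n := n) (c L) (dn (u L))
    (fun Φ => ∀ d, d < L → (Φ (c (d + 1)) (u (d + 1))).1 = (Φ (c d) (dn (u d))).1)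
    (fun Φ => (Φ (c a) j).1) ?_ ?_
  rotate_left
  · intro Φ x
    refine forall_congr' fun d => forall_congr' fun hd => ?_
    have h2 : c d ≠ c L := hne d hd
    rw [Function.update_of_ne h2]
    rcases Nat.lt_or_ge (d + 1) L with hd1 | hd1
    · rw [Function.update_of_ne (hne (d + 1) hd1)]
    · have hdL : d + 1 = L := by omega
      rw [hdL, Function.update_self, Function.update_of_ne hdn.symm]
  · intro Φ x
    simp only [Function.update_of_ne (hne a ha)]
  rw [pow_succ, ← mul_assoc, mul_comm _ n, ← mul_assoc, mul_comm n, ← sissP_pathCount dn u L c hinj]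
  congr 1

end PeelPath

end Summit.PneNP.PneNP.Theorems
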